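import Summits.BirchSwinnertonDyer.BirchSwinnertonDyer.Theses.PlecticLegs
import Literature.Barriers.BirchSwinnertonDyer.RankNotSumOfLocalInvariantsC3C3Proofs
import Literature.Barriers.BirchSwinnertonDyer.RankNotSumOfLocalInvariantsF4TwistPoints
import Literature.NumberTheory.EllipticCurves.TwoDescentLinearConditions
import Literature.NumberTheory.EllipticCurves.SelmerCorankHolds
import Literature.NumberTheory.QuadraticFields.FundamentalDiscriminant
import Literature.NumberTheory.DiophantineGeometry.LocalReductionHasMultiplicativeReductionAtProofs
import Literature.NumberTheory.DiophantineGeometry.LocalReductionIsIntegralAtProofs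
import Mathlib.Tactic.NormNum.Prime

/-!
# Negative lemma for line `Sketch` of crux `PlecticLegs.PlecticRankUB` (stmt-BirchSwinnertonDyer-17519):
# stub S1 `stub_onSector_selmerCap` is false without the analytic-rank hypothesis

Refuter / crux-disprover file (Negative lane, supports stmt-BirchSwinnertonDyer-17519; it refutes
neither the crux nor the stub). Stub **S1** of the lead's skeleton (`Cruxes/PlecticRankUB/Lines/
Sketch.lean`) asserts, for `V` elliptic over a totally real `F` of degree `d ≥ 2` with
`r_an(V/F) = d` ON the plectic multiplicative sector (`∃ p S, d ≤ #S + 1 ∧ ∀ v ∈ S, p ∈ v ∧ V`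
multiplicative at `v`), that `corank_{ℤ_p} Sel_{p^∞}(V/F) ≤ d` for some prime `p`. Sorry-free:
* `PlecticRankUBNegative.three_le_mordellWeilRank_5374` — `3 ≤ rk E(ℚ)` for
  `E : y² = x(x − 53)(x − 74) = [0, −127, 0, 3922, 0]` (conductor `2⁵·3·7·37·53`, rank `3`; PARI
  `ellrank`, kit job j023845), by the tree's complete `2`-descent characters on the integral points
  `(32, 168)`, `(50, 60)`, `(242, 2772)`: `ψ = (v₂, v₃₇, v₅₃ of δ₁ = x; sgn, v₇ of δ₂ = x − 53)` takes
  the values `[1,0,0,1,1]`, `[1,0,0,1,0]`, `[1,0,0,0,1]`, `𝔽₂`-independent of `ψ(T₁) = [1,1,1,1,0]`,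
  `ψ(T₂) = [0,0,1,1,1]`.
* `PlecticRankUBNegative.hasMultiplicativeReductionAt_5374` — `E ⊗ K` is multiplicative at EVERY
  place `v ∣ 3` of EVERY number field `K` (`3 ∣ Δ = 16·(53·74·21)²`, `3 ∤ c₄ = 69808`; the tree's
  Silverman VII.5.1(b) criterion `hasMultiplicativeReductionAt_of_valuation_c₄_eq_one`).
* `stub_onSector_selmerCap_false_without_analyticRank` — S1 with `V.analyticRank = [F:ℚ]` deleted is
  FALSE: `F = ℚ(√5)`, `V = E ⊗ F`, `p = 3`, `S = {v ∣ 3}` put `V` on the sector, while for EVERY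
  prime `p`, `corank Sel_{p^∞}(V/F) = rank + corank Ш[p^∞] ≥ 3 > 2` (proved Kummer identity
  `selmerCorank_eq_mordellWeilRank_add_holds`).
Consequence for the lead: the sector hypothesis is geometry, not arithmetic — the Selmer cap on the
sector must come out of `ord_{s=1} L(V/F,s) = d` (the card's ignition/reciprocity input), exactly as
for the crux; multiplicative legs alone give nothing. [folklore]
-/

noncomputable section

open scoped Classical

open WeierstrassCurve WeierstrassCurve.Affine WeierstrassCurve.Affine.Point
open IsDedekindDomain NumberField
open Literature.NumberTheory.EllipticCurves Literature.NumberTheory.EllipticCurves.KramerTwoDescent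
open Literature.NumberTheory.EllipticCurves.TwoDescentLocal
open Literature.Barriers.BirchSwinnertonDyer.DokchitserDokchitser2011

namespace Summit.BirchSwinnertonDyer.BirchSwinnertonDyer.Theorems

/-- Rational `2`-torsion `0, 53, 74` of `E = [0, −127, 0, 3922, 0]`. [folklore] -/
theorem PlecticRankUBNegative.hsplit_5374 :
    (⟨0, -127, 0, 3922, 0⟩ : WeierstrassCurve ℚ).toAffine.SplitTwoTorsion 0 53 74 := by
  refine ⟨?_, ?_, ?_⟩
  · show WeierstrassCurve.b₂ _ = _
    rw [WeierstrassCurve.b₂]; norm_num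
  · show WeierstrassCurve.b₄ _ = _
    rw [WeierstrassCurve.b₄]; norm_num
  · show WeierstrassCurve.b₆ _ = _
    rw [WeierstrassCurve.b₆]; norm_num

/-- `E` is an elliptic curve (`Δ = 16·(53·74·21)² ≠ 0`). [folklore] -/
theorem PlecticRankUBNegative.isElliptic_5374 :
    (⟨0, -127, 0, 3922, 0⟩ : WeierstrassCurve ℚ).IsElliptic := by
  rw [WeierstrassCurve.isElliptic_iff]
  have h : (⟨0, -127, 0, 3922, 0⟩ : WeierstrassCurve ℚ).Δ =
      16 * ((0 - 53) * (0 - 74) * (53 - 74)) ^ 2 := PlecticRankUBNegative.hsplit_5374.Δ_eq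
  rw [h, isUnit_iff_ne_zero]
  norm_num

/-- Nonsingularity on `E` is the equation `y² = x³ − 127x² + 3922x`. [folklore] -/
theorem PlecticRankUBNegative.nonsingular_5374_iff (x y : ℚ) :
    (⟨0, -127, 0, 3922, 0⟩ : WeierstrassCurve ℚ).toAffine.Nonsingular x y ↔
      y ^ 2 = x ^ 3 - 127 * x ^ 2 + 3922 * x := by
  haveI := PlecticRankUBNegative.isElliptic_5374
  rw [← WeierstrassCurve.Affine.equation_iff_nonsingular, WeierstrassCurve.Affine.equation_iff]
  simp only
  constructor <;> intro h <;> linear_combination h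

/-- **`3 ≤ rk E(ℚ)`** for `E : y² = x(x − 53)(x − 74)` by the complete `2`-descent (Silverman AEC
Prop. X.1.4): with `ψ = (v₂, v₃₇, v₅₃ of δ₁ = x, sign and v₇ of δ₂ = x − 53) : E(ℚ) → 𝔽₂⁵`, the
values at `P₁ = (32, 168)`, `P₂ = (50, 60)`, `P₃ = (242, 2772)`, `T₁ = (0, 0)`, `T₂ = (53, 0)` are
`𝔽₂`-linearly independent. [cite: SilvermanAEC2009, Prop. X.1.4] -/
theorem PlecticRankUBNegative.three_le_mordellWeilRank_5374 :
    3 ≤ (⟨0, -127, 0, 3922, 0⟩ : WeierstrassCurve ℚ).mordellWeilRank := by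
  haveI hE := PlecticRankUBNegative.isElliptic_5374
  haveI : Fact (Nat.Prime 37) := ⟨by norm_num⟩; haveI : Fact (Nat.Prime 53) := ⟨by norm_num⟩
  haveI : Fact (Nat.Prime 7) := ⟨by norm_num⟩
  have hsplit := PlecticRankUBNegative.hsplit_5374
  obtain ⟨ψ, hψ⟩ : ∃ ψ : (⟨0, -127, 0, 3922, 0⟩ : WeierstrassCurve ℚ).toAffine.Point →+
      (Fin 5 → ZMod 2),
      ∀ P, ψ P = ![charFst hsplit (parityHom 2) P, charFst hsplit (parityHom 37) P,
        charFst hsplit (parityHom 53) P, charSnd hsplit signHom P, charSnd hsplit (parityHom 7) P] :=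
    ⟨AddMonoidHom.pi fun i => (![charFst hsplit (parityHom 2), charFst hsplit (parityHom 37),
        charFst hsplit (parityHom 53), charSnd hsplit signHom, charSnd hsplit (parityHom 7)] :
          Fin 5 → ((⟨0, -127, 0, 3922, 0⟩ : WeierstrassCurve ℚ).toAffine.Point →+ ZMod 2)) i,
      fun P => by ext i; fin_cases i <;> rfl⟩
  have ψ_some : ∀ {x y : ℚ}
      (hP : (⟨0, -127, 0, 3922, 0⟩ : WeierstrassCurve ℚ).toAffine.Nonsingular x y),
      x ≠ 0 → x ≠ 53 → ψ (.some x y hP) = ![parityBit 2 (x - 0), parityBit 37 (x - 0),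
        parityBit 53 (x - 0), signBit (x - 53), parityBit 7 (x - 53)] := by
    intro x y hP hx₁ hx₂
    have hx₁' : x - 0 ≠ 0 := sub_ne_zero.mpr hx₁
    have hx₂' : x - 53 ≠ 0 := sub_ne_zero.mpr hx₂
    rw [hψ]
    ext i
    fin_cases i
    · show charFst hsplit (parityHom 2) (.some x y hP) = parityBit 2 (x - 0)
      rw [charFst_apply, twoDescentComponent_some_of_ne hP hx₁, parityHom_sqClass hx₁']
    · show charFst hsplit (parityHom 37) (.some x y hP) = parityBit 37 (x - 0)
      rw [charFst_apply, twoDescentComponent_some_of_ne hP hx₁, parityHom_sqClass hx₁']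
    · show charFst hsplit (parityHom 53) (.some x y hP) = parityBit 53 (x - 0)
      rw [charFst_apply, twoDescentComponent_some_of_ne hP hx₁, parityHom_sqClass hx₁']
    · show charSnd hsplit signHom (.some x y hP) = signBit (x - 53)
      rw [charSnd_apply, twoDescentComponent_some_of_ne hP hx₂, signHom_sqClass hx₂']
    · show charSnd hsplit (parityHom 7) (.some x y hP) = parityBit 7 (x - 53)
      rw [charSnd_apply, twoDescentComponent_some_of_ne hP hx₂, parityHom_sqClass hx₂']
  -- `ψ(T₁)`, `T₁ = (0, 0)`: `δ₁ = (e₁-e₂)(e₁-e₃) = 3922 = 2·37·53`, `δ₂ = -53`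
  have ψ_T1 : ψ (.some _ _ (nonsingular_twoTorsion hsplit)) = ![1, 1, 1, 1, 0] := by
    have h₁ : (((0 : ℚ) - 53) * ((0 : ℚ) - 74)) ≠ 0 := by norm_num
    have h₂ : ((0 : ℚ) - 53) ≠ 0 := by norm_num
    rw [hψ]
    ext i
    fin_cases i
    · show charFst hsplit (parityHom 2) _ = 1
      rw [charFst_apply, twoDescentComponent_some_of_eq _ rfl, parityHom_sqClass h₁]
      exact parityBit_eq_of_eq 2 1 (u := 1961) (v := 1) (1) (Or.inl rfl) (by norm_num) (by norm_num) (by norm_num)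
    · show charFst hsplit (parityHom 37) _ = 1
      rw [charFst_apply, twoDescentComponent_some_of_eq _ rfl, parityHom_sqClass h₁]
      exact parityBit_eq_of_eq 37 1 (u := 106) (v := 1) (1) (Or.inl rfl) (by norm_num) (by norm_num) (by norm_num)
    · show charFst hsplit (parityHom 53) _ = 1
      rw [charFst_apply, twoDescentComponent_some_of_eq _ rfl, parityHom_sqClass h₁]
      exact parityBit_eq_of_eq 53 1 (u := 74) (v := 1) (1) (Or.inl rfl) (by norm_num) (by norm_num) (by norm_num)
    · show charSnd hsplit signHom _ = 1
      rw [charSnd_apply, twoDescentComponent_some_of_ne _ (by norm_num), signHom_sqClass h₂]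
      exact signBit_of_neg (by norm_num)
    · show charSnd hsplit (parityHom 7) _ = 0
      rw [charSnd_apply, twoDescentComponent_some_of_ne _ (by norm_num), parityHom_sqClass h₂]
      exact parityBit_eq_of_eq 7 0 (u := 53) (v := 1) (-1) (Or.inr rfl) (by norm_num) (by norm_num) (by norm_num)
  -- `ψ(T₂)`, `T₂ = (53, 0)`: `δ₁ = 53`, `δ₂ = (e₂-e₁)(e₂-e₃) = -1113 = -(3·7·53)`
  have ψ_T2 : ψ (.some _ _ (nonsingular_twoTorsion hsplit.swap₁₂)) = ![0, 0, 1, 1, 1] := by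
    have h₁ : ((53 : ℚ) - 0) ≠ 0 := by norm_num
    have h₂ : (((53 : ℚ) - 0) * ((53 : ℚ) - 74)) ≠ 0 := by norm_num
    rw [hψ]
    ext i
    fin_cases i
    · show charFst hsplit (parityHom 2) _ = 0
      rw [charFst_apply, twoDescentComponent_some_of_ne _ (by norm_num), parityHom_sqClass h₁]
      exact parityBit_eq_of_eq 2 0 (u := 53) (v := 1) (1) (Or.inl rfl) (by norm_num) (by norm_num) (by norm_num)
    · show charFst hsplit (parityHom 37) _ = 0
      rw [charFst_apply, twoDescentComponent_some_of_ne _ (by norm_num), parityHom_sqClass h₁]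
      exact parityBit_eq_of_eq 37 0 (u := 53) (v := 1) (1) (Or.inl rfl) (by norm_num) (by norm_num) (by norm_num)
    · show charFst hsplit (parityHom 53) _ = 1
      rw [charFst_apply, twoDescentComponent_some_of_ne _ (by norm_num), parityHom_sqClass h₁]
      exact parityBit_eq_of_eq 53 1 (u := 1) (v := 1) (1) (Or.inl rfl) (by norm_num) (by norm_num) (by norm_num)
    · show charSnd hsplit signHom _ = 1
      rw [charSnd_apply, twoDescentComponent_some_of_eq _ rfl, signHom_sqClass h₂]
      exact signBit_of_neg (by norm_num)
    · show charSnd hsplit (parityHom 7) _ = 1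
      rw [charSnd_apply, twoDescentComponent_some_of_eq _ rfl, parityHom_sqClass h₂]
      exact parityBit_eq_of_eq 7 1 (u := 159) (v := 1) (-1) (Or.inr rfl) (by norm_num) (by norm_num) (by norm_num)
  -- `ψ(T₃)`, `T₃ = (74, 0)`: `δ₁ = 74 = 2·37`, `δ₂ = 21 = 3·7`
  have ψ_T3 : ψ (.some _ _ (nonsingular_twoTorsion hsplit.swap₂₃.swap₁₂)) = ![1, 1, 0, 0, 1] := by
    have h₁ : ((74 : ℚ) - 0) ≠ 0 := by norm_num
    have h₂ : ((74 : ℚ) - 53) ≠ 0 := by norm_num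
    rw [hψ]
    ext i
    fin_cases i
    · show charFst hsplit (parityHom 2) _ = 1
      rw [charFst_apply, twoDescentComponent_some_of_ne _ (by norm_num), parityHom_sqClass h₁]
      exact parityBit_eq_of_eq 2 1 (u := 37) (v := 1) (1) (Or.inl rfl) (by norm_num) (by norm_num) (by norm_num)
    · show charFst hsplit (parityHom 37) _ = 1
      rw [charFst_apply, twoDescentComponent_some_of_ne _ (by norm_num), parityHom_sqClass h₁]
      exact parityBit_eq_of_eq 37 1 (u := 2) (v := 1) (1) (Or.inl rfl) (by norm_num) (by norm_num) (by norm_num)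
    · show charFst hsplit (parityHom 53) _ = 0
      rw [charFst_apply, twoDescentComponent_some_of_ne _ (by norm_num), parityHom_sqClass h₁]
      exact parityBit_eq_of_eq 53 0 (u := 74) (v := 1) (1) (Or.inl rfl) (by norm_num) (by norm_num) (by norm_num)
    · show charSnd hsplit signHom _ = 0
      rw [charSnd_apply, twoDescentComponent_some_of_ne _ (by norm_num), signHom_sqClass h₂]
      exact signBit_of_nonneg (by norm_num)
    · show charSnd hsplit (parityHom 7) _ = 1
      rw [charSnd_apply, twoDescentComponent_some_of_ne _ (by norm_num), parityHom_sqClass h₂]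
      exact parityBit_eq_of_eq 7 1 (u := 3) (v := 1) (1) (Or.inl rfl) (by norm_num) (by norm_num) (by norm_num)
  have hP1 : (⟨0, -127, 0, 3922, 0⟩ : WeierstrassCurve ℚ).toAffine.Nonsingular 32 168 :=
    (PlecticRankUBNegative.nonsingular_5374_iff _ _).mpr (by norm_num)
  have hP2 : (⟨0, -127, 0, 3922, 0⟩ : WeierstrassCurve ℚ).toAffine.Nonsingular 50 60 :=
    (PlecticRankUBNegative.nonsingular_5374_iff _ _).mpr (by norm_num)
  have hP3 : (⟨0, -127, 0, 3922, 0⟩ : WeierstrassCurve ℚ).toAffine.Nonsingular 242 2772 :=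
    (PlecticRankUBNegative.nonsingular_5374_iff _ _).mpr (by norm_num)
  -- `ψ(P₁)`: `x = 32 = 2⁵`, `x - 53 = -21 = -(3·7)`
  have ψ_pt1 : ψ (.some _ _ hP1) = ![1, 0, 0, 1, 1] := by
    rw [ψ_some hP1 (by norm_num) (by norm_num)]
    ext i
    fin_cases i
    · show parityBit 2 _ = 1
      exact parityBit_eq_of_eq 2 5 (u := 1) (v := 1) (1) (Or.inl rfl) (by norm_num) (by norm_num) (by norm_num)
    · show parityBit 37 _ = 0
      exact parityBit_eq_of_eq 37 0 (u := 32) (v := 1) (1) (Or.inl rfl) (by norm_num) (by norm_num) (by norm_num)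
    · show parityBit 53 _ = 0
      exact parityBit_eq_of_eq 53 0 (u := 32) (v := 1) (1) (Or.inl rfl) (by norm_num) (by norm_num) (by norm_num)
    · show signBit _ = 1
      exact signBit_of_neg (by norm_num)
    · show parityBit 7 _ = 1
      exact parityBit_eq_of_eq 7 1 (u := 3) (v := 1) (-1) (Or.inr rfl) (by norm_num) (by norm_num) (by norm_num)
  -- `ψ(P₂)`: `x = 50 = 2·5²`, `x - 53 = -3`
  have ψ_pt2 : ψ (.some _ _ hP2) = ![1, 0, 0, 1, 0] := by
    rw [ψ_some hP2 (by norm_num) (by norm_num)]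
    ext i
    fin_cases i
    · show parityBit 2 _ = 1
      exact parityBit_eq_of_eq 2 1 (u := 25) (v := 1) (1) (Or.inl rfl) (by norm_num) (by norm_num) (by norm_num)
    · show parityBit 37 _ = 0
      exact parityBit_eq_of_eq 37 0 (u := 50) (v := 1) (1) (Or.inl rfl) (by norm_num) (by norm_num) (by norm_num)
    · show parityBit 53 _ = 0
      exact parityBit_eq_of_eq 53 0 (u := 50) (v := 1) (1) (Or.inl rfl) (by norm_num) (by norm_num) (by norm_num)
    · show signBit _ = 1
      exact signBit_of_neg (by norm_num)
    · show parityBit 7 _ = 0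
      exact parityBit_eq_of_eq 7 0 (u := 3) (v := 1) (-1) (Or.inr rfl) (by norm_num) (by norm_num) (by norm_num)
  -- `ψ(P₃)`: `x = 242 = 2·11²`, `x - 53 = 189 = 3³·7`
  have ψ_pt3 : ψ (.some _ _ hP3) = ![1, 0, 0, 0, 1] := by
    rw [ψ_some hP3 (by norm_num) (by norm_num)]
    ext i
    fin_cases i
    · show parityBit 2 _ = 1
      exact parityBit_eq_of_eq 2 1 (u := 121) (v := 1) (1) (Or.inl rfl) (by norm_num) (by norm_num) (by norm_num)
    · show parityBit 37 _ = 0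
      exact parityBit_eq_of_eq 37 0 (u := 242) (v := 1) (1) (Or.inl rfl) (by norm_num) (by norm_num) (by norm_num)
    · show parityBit 53 _ = 0
      exact parityBit_eq_of_eq 53 0 (u := 242) (v := 1) (1) (Or.inl rfl) (by norm_num) (by norm_num) (by norm_num)
    · show signBit _ = 0
      exact signBit_of_nonneg (by norm_num)
    · show parityBit 7 _ = 1
      exact parityBit_eq_of_eq 7 1 (u := 27) (v := 1) (1) (Or.inl rfl) (by norm_num) (by norm_num) (by norm_num)
  refine le_mordellWeilRank_of_twoTorsion' hsplit ψ ![.some _ _ hP1, .some _ _ hP2, .some _ _ hP3] ?_ ?_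
  · rw [ψ_T1, ψ_T2, ψ_T3]; decide
  · intro c ε₁ ε₂ hc
    simp only [Fin.sum_univ_succ, Fin.sum_univ_zero, Matrix.cons_val_zero, Matrix.cons_val_succ,
      ψ_pt1, ψ_pt2, ψ_pt3, ψ_T1, ψ_T2] at hc
    revert hc ε₁ ε₂ c
    decide

/-- A number field has a finite place above `3` (`3` is not a unit of `𝓞 K`: its norm is
`3^{[K:ℚ]} ≠ ±1`). [folklore] -/
theorem PlecticRankUBNegative.exists_mem_asIdeal_three (K : Type) [Field K] [NumberField K] :
    ∃ v : HeightOneSpectrum (𝓞 K), ((3 : ℕ) : 𝓞 K) ∈ v.asIdeal := by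
  have hnu : ¬ IsUnit (((3 : ℕ) : 𝓞 K)) := fun h => by
    have h1 := h.map (Algebra.norm ℤ)
    rw [← map_natCast (algebraMap ℤ (𝓞 K)) 3, Algebra.norm_algebraMap, Int.isUnit_iff_natAbs_eq,
      Int.natAbs_pow, Int.natAbs_natCast] at h1
    exact (Nat.one_lt_pow (Module.finrank_pos (R := ℤ) (M := 𝓞 K)).ne' (by norm_num)).ne' h1
  obtain ⟨M, hM, hle⟩ := Ideal.exists_le_maximal (Ideal.span {((3 : ℕ) : 𝓞 K)})
    (by rwa [Ne, Ideal.span_singleton_eq_top])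
  refine ⟨⟨M, hM.isPrime, fun hbot => ?_⟩, hle (Ideal.mem_span_singleton_self _)⟩
  have h := hle (Ideal.mem_span_singleton_self _)
  rw [hbot, Ideal.mem_bot] at h
  exact (Nat.cast_ne_zero.2 (by norm_num)) h

/-- The valuation at a finite place of an integer of `K` is `≤ 1`. [folklore] -/
theorem PlecticRankUBNegative.valuation_intCast_le_one {K : Type} [Field K] [NumberField K]
    (v : HeightOneSpectrum (𝓞 K)) (n : ℤ) : v.valuation K (n : K) ≤ 1 := by
  rw [← map_intCast (algebraMap (𝓞 K) K) n]
  exact v.valuation_le_one _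

/-- The valuation at a finite place `v` of an integer `n` of `K` is `< 1` iff `n ∈ v`. [folklore] -/
theorem PlecticRankUBNegative.valuation_intCast_lt_one_iff {K : Type} [Field K] [NumberField K]
    (v : HeightOneSpectrum (𝓞 K)) (n : ℤ) : v.valuation K (n : K) < 1 ↔ (n : 𝓞 K) ∈ v.asIdeal := by
  rw [← map_intCast (algebraMap (𝓞 K) K) n]
  exact v.valuation_lt_one_iff_mem _

/-- **`E ⊗ K` has multiplicative reduction at every place above `3`** of every number field `K`:
the equation `[0, −127, 0, 3922, 0]` is `v`-integral, `3 ∤ c₄ = 69808` (`69808 − 3·23269 = 1`, so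
`c₄` is a `v`-unit) and `3 ∣ Δ = 16·(53·74·21)² = 3 · 36178661568` (so `v(Δ) < 1`); conclude by
the tree's Silverman VII.5.1(b) criterion `hasMultiplicativeReductionAt_of_valuation_c₄_eq_one`.
[cite: SilvermanAEC2009, Prop. VII.5.1] -/
theorem PlecticRankUBNegative.hasMultiplicativeReductionAt_5374 (K : Type) [Field K] [NumberField K]
    (v : HeightOneSpectrum (𝓞 K)) (hv : ((3 : ℕ) : 𝓞 K) ∈ v.asIdeal) :
    ((⟨0, -127, 0, 3922, 0⟩ : WeierstrassCurve ℚ).baseChange K).HasMultiplicativeReductionAt v := by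
  haveI := PlecticRankUBNegative.isElliptic_5374
  haveI : ((⟨0, -127, 0, 3922, 0⟩ : WeierstrassCurve ℚ).baseChange K).IsElliptic :=
    inferInstanceAs ((⟨0, -127, 0, 3922, 0⟩ : WeierstrassCurve ℚ).map (algebraMap ℚ K)).IsElliptic
  have hv' : ((3 : ℤ) : 𝓞 K) ∈ v.asIdeal := by exact_mod_cast hv
  have h3 : v.valuation K ((3 : ℤ) : K) < 1 :=
    (PlecticRankUBNegative.valuation_intCast_lt_one_iff v 3).mpr hv'
  have hint : ((⟨0, -127, 0, 3922, 0⟩ : WeierstrassCurve ℚ).baseChange K).IsIntegralAt v := by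
    rw [isIntegralAt_iff_valuation_le_one]
    refine ⟨?_, ?_, ?_, ?_, ?_⟩
    · simp [WeierstrassCurve.baseChange, WeierstrassCurve.map]
    · have := PlecticRankUBNegative.valuation_intCast_le_one v (-127)
      simpa [WeierstrassCurve.baseChange, WeierstrassCurve.map] using this
    · simp [WeierstrassCurve.baseChange, WeierstrassCurve.map]
    · have := PlecticRankUBNegative.valuation_intCast_le_one v 3922
      simpa [WeierstrassCurve.baseChange, WeierstrassCurve.map] using this
    · simp [WeierstrassCurve.baseChange, WeierstrassCurve.map]
  -- `c₄ = 69808` is a `v`-unit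
  have hc₄ : v.valuation K ((⟨0, -127, 0, 3922, 0⟩ : WeierstrassCurve ℚ).baseChange K).c₄ = 1 := by
    have hc : ((⟨0, -127, 0, 3922, 0⟩ : WeierstrassCurve ℚ).baseChange K).c₄ = ((69808 : ℤ) : K) := by
      rw [WeierstrassCurve.baseChange, map_c₄,
        show (⟨0, -127, 0, 3922, 0⟩ : WeierstrassCurve ℚ).c₄ = 69808 by
          rw [WeierstrassCurve.c₄, WeierstrassCurve.b₂, WeierstrassCurve.b₄]; norm_num]
      simp
    rw [hc]
    refine le_antisymm (PlecticRankUBNegative.valuation_intCast_le_one v _) (not_lt.mp fun hlt => ?_)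
    have hmem : ((69808 : ℤ) : 𝓞 K) ∈ v.asIdeal :=
      (PlecticRankUBNegative.valuation_intCast_lt_one_iff v 69808).mp hlt
    have h1 : (1 : 𝓞 K) = ((69808 : ℤ) : 𝓞 K) - ((23269 : ℤ) : 𝓞 K) * ((3 : ℤ) : 𝓞 K) := by
      push_cast; norm_num
    exact v.isPrime.ne_top ((Ideal.eq_top_iff_one _).mpr
      (h1 ▸ v.asIdeal.sub_mem hmem (v.asIdeal.mul_mem_left _ hv')))
  -- `Δ = 3 · 36178661568` lies in `v`
  have hΔ : v.valuation K ((⟨0, -127, 0, 3922, 0⟩ : WeierstrassCurve ℚ).baseChange K).Δ < 1 := by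
    have hd : ((⟨0, -127, 0, 3922, 0⟩ : WeierstrassCurve ℚ).baseChange K).Δ =
        ((3 : ℤ) : K) * ((36178661568 : ℤ) : K) := by
      rw [WeierstrassCurve.baseChange, map_Δ,
        show (⟨0, -127, 0, 3922, 0⟩ : WeierstrassCurve ℚ).Δ = 3 * 36178661568 by
          rw [PlecticRankUBNegative.hsplit_5374.Δ_eq]; norm_num]
      simp
    rw [hd, _root_.map_mul]
    calc v.valuation K ((3 : ℤ) : K) * v.valuation K ((36178661568 : ℤ) : K)
        ≤ v.valuation K ((3 : ℤ) : K) * 1 :=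
          mul_le_mul_right (PlecticRankUBNegative.valuation_intCast_le_one v _) _
      _ = v.valuation K ((3 : ℤ) : K) := mul_one _
      _ < 1 := h3
  exact hasMultiplicativeReductionAt_of_valuation_c₄_eq_one hint hc₄ hΔ

/-- **The on-sector witness.** There is a totally real number field `F` of degree `2`, an elliptic
curve `V/F` ON the plectic multiplicative sector at `p = 3` (one place `v ∣ 3` of multiplicative
reduction, `2 ≤ 1 + 1`) with `rank_ℤ V(F) ≥ 3`: `F = ℚ(√5)`, `V = E ⊗ F`,
`E : y² = x(x − 53)(x − 74)`. [folklore] -/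
theorem PlecticRankUBNegative.exists_onSector_witness :
    ∃ (F : Type) (_ : Field F) (_ : NumberField F), NumberField.IsTotallyReal F ∧
      Module.finrank ℚ F = 2 ∧ ∃ V : WeierstrassCurve F, V.IsElliptic ∧ 3 ≤ V.mordellWeilRank ∧
        ∃ S : Finset (HeightOneSpectrum (𝓞 F)), Module.finrank ℚ F ≤ S.card + 1 ∧
          ∀ v ∈ S, ((3 : ℕ) : 𝓞 F) ∈ v.asIdeal ∧ V.HasMultiplicativeReductionAt v := by
  obtain ⟨K, _, _, h2, hdK⟩ :=
    Literature.NumberTheory.QuadraticFields.Quadratic.exists_numberField_discr_eq (D := 5)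
      (Or.inl ⟨by norm_num, by rw [← Int.squarefree_natAbs]; exact Nat.prime_five.squarefree,
        by norm_num⟩)
  have hreal : NumberField.IsTotallyReal K := by
    rw [← NumberField.nrComplexPlaces_eq_zero_iff]
    have hsign := NumberField.sign_discr K
    rw [hdK] at hsign
    have heven : Even (NumberField.InfinitePlace.nrComplexPlaces K) := by
      by_contra hodd
      rw [Nat.not_even_iff_odd] at hodd
      rw [hodd.neg_one_pow] at hsign
      norm_num at hsign
    have hrk := NumberField.InfinitePlace.card_add_two_mul_card_eq_rank K
    rw [h2] at hrk
    obtain ⟨m, hm⟩ := heven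
    omega
  haveI hE := PlecticRankUBNegative.isElliptic_5374
  obtain ⟨v, hv⟩ := PlecticRankUBNegative.exists_mem_asIdeal_three K
  refine ⟨K, inferInstance, inferInstance, hreal, h2,
    (⟨0, -127, 0, 3922, 0⟩ : WeierstrassCurve ℚ).baseChange K,
    inferInstanceAs ((⟨0, -127, 0, 3922, 0⟩ : WeierstrassCurve ℚ).map (algebraMap ℚ K)).IsElliptic,
    ?_, {v}, by rw [h2, Finset.card_singleton], ?_⟩
  · have hmono := mordellWeilRank_baseChange_le_of_algHom (F := K)
      (⟨0, -127, 0, 3922, 0⟩ : WeierstrassCurve ℚ) (Algebra.ofId ℚ K)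
    have hid : (⟨0, -127, 0, 3922, 0⟩ : WeierstrassCurve ℚ).baseChange ℚ =
        (⟨0, -127, 0, 3922, 0⟩ : WeierstrassCurve ℚ) := by
      rw [WeierstrassCurve.baseChange, RingHom.ext_rat (algebraMap ℚ ℚ) (RingHom.id ℚ),
        WeierstrassCurve.map_id]
    rw [hid] at hmono
    exact PlecticRankUBNegative.three_le_mordellWeilRank_5374.trans hmono
  · intro w hw
    rw [Finset.mem_singleton] at hw
    rw [hw]
    exact ⟨hv, PlecticRankUBNegative.hasMultiplicativeReductionAt_5374 K v hv⟩

/-- **Stub S1 `stub_onSector_selmerCap` of line `Sketch` is false without the analytic-rank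
hypothesis** (negative lemma supporting stmt-BirchSwinnertonDyer-17519; not a refutation of the stub
or the crux). The negated statement is the registered signature of `stub_onSector_selmerCap` verbatim
with the single hypothesis `V.analyticRank = Module.finrank ℚ F` deleted. Witness: `F = ℚ(√5)`,
`V = E ⊗ F` (`E : y² = x(x−53)(x−74)`), on the sector at `p = 3`, while for EVERY prime `p`,
`corank Sel_{p^∞}(V/F) = rank V(F) + corank Ш(V/F)[p^∞] ≥ 3 > 2` (Kummer identity, proved in tree).
[folklore] -/
theorem stub_onSector_selmerCap_false_without_analyticRank :
    ¬ (∀ (F : Type) [Field F] [NumberField F] [NumberField.IsTotallyReal F] (V : WeierstrassCurve F)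
      [V.IsElliptic], 2 ≤ Module.finrank ℚ F →
      (∃ p : ℕ, p.Prime ∧ ∃ S : Finset (HeightOneSpectrum (𝓞 F)),
          Module.finrank ℚ F ≤ S.card + 1 ∧
            ∀ v ∈ S, (p : 𝓞 F) ∈ v.asIdeal ∧ V.HasMultiplicativeReductionAt v) →
      ∃ p : ℕ, p.Prime ∧ V.selmerCorank p ≤ Module.finrank ℚ F) := by
  intro h
  obtain ⟨F, _, _, hreal, h2, V, hV, h3, S, hS, hmult⟩ :=
    PlecticRankUBNegative.exists_onSector_witness
  haveI := hreal
  haveI := hV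
  obtain ⟨p, hp, hcap⟩ := h F V (by omega) ⟨3, Nat.prime_three, S, hS, hmult⟩
  haveI : Fact p.Prime := ⟨hp⟩
  have hk : V.selmerCorank p = V.mordellWeilRank + V.shaCorank p :=
    V.selmerCorank_eq_mordellWeilRank_add_holds p
  omega

end Summit.BirchSwinnertonDyer.BirchSwinnertonDyer.Theorems

end
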